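import Mathlib
import Literature.AlgebraicGeometry.Resolution.CobordantGame
import Literature.AlgebraicGeometry.Resolution.CobordantChartCoefficients
import Literature.AlgebraicGeometry.Resolution.CobordantTupleGame
import Literature.AlgebraicGeometry.Resolution.FormalCoordinateChange
import Summits.ResolutionOfSingularities.ResolutionOfSingularities.Theorems.WeightedInvariantGlobalizeLocalDropCanonize
import Summits.ResolutionOfSingularities.ResolutionOfSingularities.Theorems.WeightedInvariantLocalWeightedDropTangentConeCut
import Summits.ResolutionOfSingularities.ResolutionOfSingularities.Theorems.WeightedInvariantLocalWeightedDropMonicPointBlowup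
import Summits.ResolutionOfSingularities.ResolutionOfSingularities.Theorems.WeightedInvariantLocalWeightedDropMonicCurveBlowup
import Summits.ResolutionOfSingularities.ResolutionOfSingularities.Theorems.WeightedInvariantLocalWeightedDropMonicRecentre
import Summits.ResolutionOfSingularities.ResolutionOfSingularities.Theorems.WeightedInvariantLocalWeightedDropMonicDoublePointLift
import Summits.ResolutionOfSingularities.ResolutionOfSingularities.Theorems.WeightedInvariantLocalWeightedDropCharTwoDoublePointMonic
import Summits.ResolutionOfSingularities.ResolutionOfSingularities.Theorems.WeightedInvariantLocalWeightedDropPlaneWon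
import Summits.ResolutionOfSingularities.ResolutionOfSingularities.Theorems.WeightedInvariantLocalWeightedDropMonomialWon

/-!
# `WeightedInvariant.LocalWeightedDrop`, line `hasse-ridge-face-selection`: the monic double-point lift for REDUCED positions (N4″)

Crux item stmt-ResolutionOfSingularities-8899 `LocalWeightedDrop` (route `ResolutionOfSingularities/WeightedInvariant`), serving
the door `WeightedConstruction` stmt-ResolutionOfSingularities-0571.  [OURS · L1 W4.3, chain w43, lead prover: the registered sub-stub
N4″ of the piece S2 `stub_charTwoDoublePointSurfaceWon` of skeleton v21.  Not a statement of any manuscript.]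

The lift with formal re-presentations (`monicDoublePointsWon_of_formalRank`, sibling file `…MonicDoublePointLiftFormal`) still asks the
rank player to win the NON-REDUCED positions `y² + 2ry + r² = (y + r)²` (e.g. `(A₀, A₁) = (0, 0)`, the double plane `y²`), which no
point or curve blow-up ever improves (every successor is again a double plane) — in the full game they are won OUTRIGHT by the divisor
move `y ↦ s(c + y′)` (`stub_monomialWon`, p113582).  This file removes them from the rank player's duty:

* `MonicDoublePointLiftReduced.won_monic_two_sq` — `y² + 2ry + r²` (`r(0) = 0`) is won (re-centre to `y²`, then `stub_monomialWon`);
* `monicDoublePointsWon_of_reducedFormalRank` (N3″) — the lift of the sibling file with the step property demanded ONLY at positions that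
  are not of the form `(r², 2r)`; at the excluded positions the lift wins directly;
* `charTwoDoublePointSurfaceWon_of_reducedFormalRank` — at `n = 0`, `p = 2`, `k = k̄`: the existence of such a rank (statement N4″, spelled
  out verbatim as the hypothesis) gives the registered piece S2 VERBATIM.

N4″ is the S2 sub-stub registered in skeleton v21.  Its rank player owns exactly the centres of Cossart–Jannsen–Saito's algorithm (closed
points; regular equimultiple curves, all presentable as `V(x₁, y)` after a formal re-presentation keeping the Weierstrass degree `2`) and meets
exactly its very near points (singular, square tangent quadric) — the hyperbolic ones (`e ≤ 1`) and the non-reduced ones are exits.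
-/

set_option linter.dupNamespace false -- mandated namespace of this single-conjunct summit

namespace Summit.ResolutionOfSingularities.ResolutionOfSingularities.Theorems

open Literature.AlgebraicGeometry.Resolution
open Literature.AlgebraicGeometry.Resolution.CobordantGame

namespace MonicDoublePointLiftReduced

open MvPowerSeries

variable {k : Type} [Field k] {m : ℕ}

/-- If `ord (r²) > 2` (indeed `> 0`) then `r(0) = 0`. -/
theorem constantCoeff_eq_zero_of_sq {r : MvPowerSeries (Fin m) k} (h : (2 : ℕ∞) < (r ^ 2).order) :
    constantCoeff r = 0 := by
  have h0 : coeff (0 : Fin m →₀ ℕ) (r ^ 2) = 0 :=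
    coeff_of_lt_order (lt_of_le_of_lt (by simp) h)
  rw [coeff_zero_eq_constantCoeff, map_pow] at h0
  exact pow_eq_zero_iff (n := 2) (by norm_num) |>.mp h0

/-- The bare double plane `y²` (as the position `(0, 0)`) is won: it is a unit times a monomial (`stub_monomialWon`: the divisor move
`y ↦ s (c + y′)` has no singular successor). -/
theorem won_monic_two_zero :
    CobordantGame.Won k (m + 1) (X (Fin.last m) ^ 2 +
      (rename (Fin.succAboveEmb (Fin.last m)) (0 : MvPowerSeries (Fin m) k) +
        rename (Fin.succAboveEmb (Fin.last m)) (0 : MvPowerSeries (Fin m) k) * X (Fin.last m))) := by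
  have h := stub_monomialWon k m 1 (fun i => if i = Fin.last m then 2 else 0) one_ne_zero
  rw [one_mul, Finset.prod_eq_single (Fin.last m) (fun b _ hb => by simp [hb]) (by simp)] at h
  simpa using h

/-- The double plane `y² + 2ry + r² = (y + r)²` (`r(0) = 0`) is won: re-centre to `y²` (`won_monic_two_recentre_iff`). -/
theorem won_monic_two_sq (r : MvPowerSeries (Fin m) k) (hr : constantCoeff r = 0) :
    CobordantGame.Won k (m + 1) (X (Fin.last m) ^ 2 +
      (rename (Fin.succAboveEmb (Fin.last m)) (r ^ 2) +
        rename (Fin.succAboveEmb (Fin.last m)) (2 * r) * X (Fin.last m))) := by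
  have h := (won_monic_two_recentre_iff r hr (0 : MvPowerSeries (Fin m) k) 0).mpr won_monic_two_zero
  simpa using h

end MonicDoublePointLiftReduced

open MonicDoublePointLift MvPowerSeries in
/-- N3″ — THE LIFT FOR REDUCED MONIC DOUBLE POINTS WITH FORMAL RE-PRESENTATIONS (every characteristic `p`, `N = n + 3` variables).
As `monicDoublePointsWon_of_formalRank`, except that the step property is demanded only at positions NOT of the form
`(A₀, A₁) = (r², 2r)` (the non-reduced double planes `(y + r)²`, won outright by `MonicDoublePointLiftReduced.won_monic_two_sq`).
Suppose every singular germ in `n + 1` variables is won (`hlow`) and there is an ordinal RANK `κ` on the pairs `(A₀, A₁)` with the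
FORMAL STEP PROPERTY `hstep`: from every position (`ord A₀ ≥ 3`, `ord A₁ ≥ 2`) the rank player names
(a) a formal re-presentation `θ₀^*(y² + A₁y + A₀) = H₀ · (y² + Ã₁y + Ã₀)` of the same germ as a position (`θ₀` with zero constant
terms and invertible linear part, `H₀(0) ≠ 0`; e.g. `θ₀ = id`), (b) a re-centring `φ` of `Ã` keeping the position shape, and
(c) EITHER the point blow-up OR a permissible curve blow-up `V(x_i, y)` of the re-centred `Ã` (with its divisibility data), such that
every SINGULAR slice `S` of the corresponding landed brick is GOOD: it carries a hyperbolic-quadric witness, or the rank player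
renormalises it FORMALLY — `θ^* S = H · (y² + A₁′y + A₀′)`, `θ` with zero constant terms and invertible linear part, `H(0) ≠ 0`,
`ord A₀′ ≥ 3`, `ord A₁′ ≥ 2` — to a position of SMALLER RANK than `(A₀, A₁)`.  Then every monic double point is won.
[OURS; the reduced-positions version of `monicDoublePointsWon_of_formalRank`.] -/
theorem monicDoublePointsWon_of_reducedFormalRank (p : ℕ) (hp : p.Prime) (k : Type) [Field k] [CharP k p] (n : ℕ)
    (hlow : ∀ g : MvPowerSeries (Fin (n + 1)) k, CobordantGame.IsSingular k g → CobordantGame.Won k (n + 1) g)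
    (κ : MvPowerSeries (Fin (n + 2)) k → MvPowerSeries (Fin (n + 2)) k → Ordinal.{0})
    (hstep : ∀ A₀ A₁ : MvPowerSeries (Fin (n + 2)) k, (2 : ℕ∞) < A₀.order → (1 : ℕ∞) < A₁.order →
      (¬ ∃ r : MvPowerSeries (Fin (n + 2)) k, A₁ = 2 * r ∧ A₀ = r ^ 2) →
      ∃ (θ₀ : Fin (n + 3) → MvPowerSeries (Fin (n + 3)) k) (H₀ : MvPowerSeries (Fin (n + 3)) k)
        (B₀ B₁ : MvPowerSeries (Fin (n + 2)) k),
        (∀ i, MvPowerSeries.constantCoeff (θ₀ i) = 0) ∧ IsUnit (FormalCoordChange.linMat θ₀).det ∧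
        MvPowerSeries.constantCoeff H₀ ≠ 0 ∧ (2 : ℕ∞) < B₀.order ∧ (1 : ℕ∞) < B₁.order ∧
        MvPowerSeries.subst θ₀ (MvPowerSeries.X (Fin.last (n + 2)) ^ 2 +
            (MvPowerSeries.rename (Fin.succAboveEmb (Fin.last (n + 2))) A₀ +
              MvPowerSeries.rename (Fin.succAboveEmb (Fin.last (n + 2))) A₁ * MvPowerSeries.X (Fin.last (n + 2)))) =
          H₀ * (MvPowerSeries.X (Fin.last (n + 2)) ^ 2 +
            (MvPowerSeries.rename (Fin.succAboveEmb (Fin.last (n + 2))) B₀ +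
              MvPowerSeries.rename (Fin.succAboveEmb (Fin.last (n + 2))) B₁ * MvPowerSeries.X (Fin.last (n + 2)))) ∧
      ∃ φ : MvPowerSeries (Fin (n + 2)) k, MvPowerSeries.constantCoeff φ = 0 ∧
        (2 : ℕ∞) < (B₀ + B₁ * φ + φ ^ 2).order ∧ (1 : ℕ∞) < (B₁ + 2 * φ).order ∧
        let good : MvPowerSeries (Fin (n + 3)) k → Prop := fun S =>
          (∃ θ : Fin (n + 3) → MvPowerSeries (Fin (n + 3)) k, (∀ i, MvPowerSeries.constantCoeff (θ i) = 0) ∧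
            IsUnit (Matrix.det (Matrix.of fun i j => MvPowerSeries.coeff (Finsupp.single j 1) (θ i))) ∧
            MvPowerSeries.coeff (Finsupp.single 0 2) (MvPowerSeries.subst θ S) = 0 ∧
            MvPowerSeries.coeff (Finsupp.single 1 2) (MvPowerSeries.subst θ S) = 0 ∧
            MvPowerSeries.coeff (Finsupp.single 0 1 + Finsupp.single 1 1) (MvPowerSeries.subst θ S) ≠ 0) ∨
          (∃ (θ : Fin (n + 3) → MvPowerSeries (Fin (n + 3)) k) (H : MvPowerSeries (Fin (n + 3)) k)
              (A₀' A₁' : MvPowerSeries (Fin (n + 2)) k),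
            (∀ i, MvPowerSeries.constantCoeff (θ i) = 0) ∧ IsUnit (FormalCoordChange.linMat θ).det ∧
            MvPowerSeries.constantCoeff H ≠ 0 ∧ (2 : ℕ∞) < A₀'.order ∧ (1 : ℕ∞) < A₁'.order ∧
            MvPowerSeries.subst θ S =
              H * (MvPowerSeries.X (Fin.last (n + 2)) ^ 2 +
                (MvPowerSeries.rename (Fin.succAboveEmb (Fin.last (n + 2))) A₀' +
                  MvPowerSeries.rename (Fin.succAboveEmb (Fin.last (n + 2))) A₁' * MvPowerSeries.X (Fin.last (n + 2)))) ∧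
            κ A₀' A₁' < κ A₀ A₁)
        ((∀ (c : Fin (n + 2) → k) (i₀ : Fin (n + 2)), c i₀ ≠ 0 → ∀ Bv : Fin 2 → MvPowerSeries (Fin (n + 3)) k,
            (∀ j : Fin 2, MvPowerSeries.subst (CobordantChart.chart (fun _ : Fin (n + 2) => 1) c)
              ((![B₀ + B₁ * φ + φ ^ 2, B₁ + 2 * φ] : Fin 2 → MvPowerSeries (Fin (n + 2)) k) j) =
              MvPowerSeries.X 0 ^ (2 - (j : ℕ) + 1) * Bv j) →
            ∀ S : MvPowerSeries (Fin (n + 3)) k, S = MvPowerSeries.X (Fin.last (n + 2)) ^ 2 +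
              ∑ j : Fin 2, MvPowerSeries.rename (Fin.succAboveEmb (Fin.last (n + 2)))
                (TupleGame.slice i₀ (MvPowerSeries.X 0 * Bv j)) * MvPowerSeries.X (Fin.last (n + 2)) ^ (j : ℕ) →
            CobordantGame.IsSingular k S → good S) ∨
         (∃ (i : Fin (n + 2)) (A' : Fin 2 → MvPowerSeries (Fin (n + 2)) k),
            (∀ j : Fin 2, ((![B₀ + B₁ * φ + φ ^ 2, B₁ + 2 * φ] : Fin 2 → MvPowerSeries (Fin (n + 2)) k) j) =
              MvPowerSeries.X i ^ (2 - (j : ℕ)) * A' j) ∧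
            (∀ j : Fin 2, MvPowerSeries.constantCoeff (A' j) = 0) ∧
            ∀ ci : k, ci ≠ 0 → ∀ S : MvPowerSeries (Fin (n + 3)) k, S = MvPowerSeries.X (Fin.last (n + 2)) ^ 2 +
              ∑ j : Fin 2, MvPowerSeries.rename (Fin.succAboveEmb (Fin.last (n + 2)))
                (MvPowerSeries.C (ci ^ (2 - (j : ℕ))) * TupleGame.slice i
                  (MvPowerSeries.subst (CobordantChart.chart (fun l : Fin (n + 2) => if l = i then 1 else 0)
                    (fun l : Fin (n + 2) => if l = i then ci else 0)) (A' j))) *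
                MvPowerSeries.X (Fin.last (n + 2)) ^ (j : ℕ) →
              CobordantGame.IsSingular k S → good S))) :
    ∀ A₀ A₁ : MvPowerSeries (Fin (n + 2)) k, (2 : ℕ∞) < A₀.order → (1 : ℕ∞) < A₁.order →
      CobordantGame.Won k (n + 3) (MvPowerSeries.X (Fin.last (n + 2)) ^ 2 +
        (MvPowerSeries.rename (Fin.succAboveEmb (Fin.last (n + 2))) A₀ +
          MvPowerSeries.rename (Fin.succAboveEmb (Fin.last (n + 2))) A₁ * MvPowerSeries.X (Fin.last (n + 2)))) := by
  classical
  suffices key : ∀ (α : Ordinal.{0}) (A₀ A₁ : MvPowerSeries (Fin (n + 2)) k), κ A₀ A₁ = α →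
      (2 : ℕ∞) < A₀.order → (1 : ℕ∞) < A₁.order →
      Won k (n + 3) (X (Fin.last (n + 2)) ^ 2 + (rename (Fin.succAboveEmb (Fin.last (n + 2))) A₀ +
        rename (Fin.succAboveEmb (Fin.last (n + 2))) A₁ * X (Fin.last (n + 2)))) from
    fun A₀ A₁ h₀ h₁ => key _ A₀ A₁ rfl h₀ h₁
  intro α
  induction α using WellFoundedLT.induction with
  | ind α ih =>
  intro A₀ A₁ hα hA₀ hA₁
  by_cases hsq : ∃ r : MvPowerSeries (Fin (n + 2)) k, A₁ = 2 * r ∧ A₀ = r ^ 2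
  · -- a double plane `(y + r)²`: won outright
    obtain ⟨r, hr₁, hr₀⟩ := hsq
    subst hr₁ hr₀
    exact MonicDoublePointLiftReduced.won_monic_two_sq r (MonicDoublePointLiftReduced.constantCoeff_eq_zero_of_sq hA₀)
  obtain ⟨θ₀, H₀, B₀, B₁, hθ₀0, hθ₀det, hH₀, hB₀, hB₁, hre, φ, hφ, hC₀, hC₁, hbr⟩ := hstep A₀ A₁ hA₀ hA₁ hsq
  -- re-present: `Won (pos A) ⟸ Won (θ₀^* pos A) = Won (H₀ · pos B) ⟸ Won (pos B)`
  rw [← won_subst_iff hθ₀0 hθ₀det, hre, won_unit_mul_iff hH₀]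
  -- re-centre
  rw [← won_monic_two_recentre_iff φ hφ B₀ B₁]
  set C₀ := B₀ + B₁ * φ + φ ^ 2 with hC₀def
  set C₁ := B₁ + 2 * φ with hC₁def
  -- a good singular slice is won
  have hgood : ∀ S : MvPowerSeries (Fin (n + 3)) k, IsSingular k S →
      ((∃ θ : Fin (n + 3) → MvPowerSeries (Fin (n + 3)) k, (∀ i, constantCoeff (θ i) = 0) ∧
          IsUnit (Matrix.det (Matrix.of fun i j => coeff (Finsupp.single j 1) (θ i))) ∧
          coeff (Finsupp.single 0 2) (subst θ S) = 0 ∧ coeff (Finsupp.single 1 2) (subst θ S) = 0 ∧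
          coeff (Finsupp.single 0 1 + Finsupp.single 1 1) (subst θ S) ≠ 0) ∨
        (∃ (θ : Fin (n + 3) → MvPowerSeries (Fin (n + 3)) k) (H : MvPowerSeries (Fin (n + 3)) k)
            (A₀' A₁' : MvPowerSeries (Fin (n + 2)) k),
          (∀ i, constantCoeff (θ i) = 0) ∧ IsUnit (FormalCoordChange.linMat θ).det ∧
          constantCoeff H ≠ 0 ∧ (2 : ℕ∞) < A₀'.order ∧ (1 : ℕ∞) < A₁'.order ∧
          subst θ S = H * (X (Fin.last (n + 2)) ^ 2 +
            (rename (Fin.succAboveEmb (Fin.last (n + 2))) A₀' +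
              rename (Fin.succAboveEmb (Fin.last (n + 2))) A₁' * X (Fin.last (n + 2)))) ∧
          κ A₀' A₁' < κ A₀ A₁)) →
      Won k (n + 3) S := by
    intro S hS hgoodS
    rcases hgoodS with hhyp | ⟨θ, H, A₀', A₁', hθ0, hθdet, hH, hA₀', hA₁', hSeq, hlt⟩
    · exact TangentConeCut.hyperbolicStartsWon hlow S hS hhyp
    · have hW' := ih _ (hα ▸ hlt) A₀' A₁' rfl hA₀' hA₁'
      have hW : Won k (n + 3) (subst θ S) := by
        rw [hSeq]
        exact (won_unit_mul_iff hH _).mpr hW'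
      exact (won_subst_iff hθ0 hθdet S).mp hW
  have hAv : ∀ j : Fin 2, ((2 - (j : ℕ) : ℕ) : ℕ∞) < (((![C₀, C₁] : Fin 2 → MvPowerSeries (Fin (n + 2)) k) j)).order := by
    intro j
    fin_cases j
    · simpa using hC₀
    · simpa using hC₁
  rw [monic_two_eq_sum]
  rcases hbr with hpoint | ⟨i, A', hdiv, hA'0, hcurve⟩
  · -- the point blow-up
    refine won_monic_of_pointBlowup p hp k (n + 2) 2 two_pos (![C₀, C₁]) hAv fun c i₀ hc Bv hBv hSs => ?_
    exact hgood _ hSs (hpoint c i₀ hc Bv hBv _ rfl hSs)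
  · -- the curve blow-up along `V(x_i, y)`
    refine won_monic_of_curveBlowup p hp k (n + 2) 2 two_pos i (![C₀, C₁]) A' hdiv hA'0 fun ci hci hSs => ?_
    exact hgood _ hSs (hcurve ci hci _ rfl hSs)

/-- S2 FROM N4″ (sorry-free given the hypothesis): over `k = k̄` of characteristic `2`, if a rank with the FORMAL step property of
`monicDoublePointsWon_of_reducedFormalRank` (at `n = 0`; demanded only off the double planes `(r², 2r) = (r², 0)`) exists on the pairs
`(A₀, A₁) ∈ k[[x₁,x₂]]²` — statement N4″, the hypothesis below, spelled out verbatim — then the registered piece S2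
`stub_charTwoDoublePointSurfaceWon` of the engine line holds VERBATIM (`charTwoDoublePointSurfaceWon_of_monicForms` + `PlaneWon.lineWon`).
[OURS · L1 W4.3; N4″ is the S2 sub-stub `stub_monicDoublePointFormalRank` of skeleton v21.] -/
theorem charTwoDoublePointSurfaceWon_of_reducedFormalRank
    (hN4 : ∀ (k : Type) [Field k] [CharP k 2] [IsAlgClosed k],
      ∃ κ : MvPowerSeries (Fin 2) k → MvPowerSeries (Fin 2) k → Ordinal.{0},
      ∀ A₀ A₁ : MvPowerSeries (Fin 2) k, (2 : ℕ∞) < A₀.order → (1 : ℕ∞) < A₁.order →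
      (¬ ∃ r : MvPowerSeries (Fin 2) k, A₁ = 2 * r ∧ A₀ = r ^ 2) →
      ∃ (θ₀ : Fin 3 → MvPowerSeries (Fin 3) k) (H₀ : MvPowerSeries (Fin 3) k) (B₀ B₁ : MvPowerSeries (Fin 2) k),
        (∀ i, MvPowerSeries.constantCoeff (θ₀ i) = 0) ∧ IsUnit (FormalCoordChange.linMat θ₀).det ∧
        MvPowerSeries.constantCoeff H₀ ≠ 0 ∧ (2 : ℕ∞) < B₀.order ∧ (1 : ℕ∞) < B₁.order ∧
        MvPowerSeries.subst θ₀ (MvPowerSeries.X (Fin.last 2) ^ 2 +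
            (MvPowerSeries.rename (Fin.succAboveEmb (Fin.last 2)) A₀ +
              MvPowerSeries.rename (Fin.succAboveEmb (Fin.last 2)) A₁ * MvPowerSeries.X (Fin.last 2))) =
          H₀ * (MvPowerSeries.X (Fin.last 2) ^ 2 +
            (MvPowerSeries.rename (Fin.succAboveEmb (Fin.last 2)) B₀ +
              MvPowerSeries.rename (Fin.succAboveEmb (Fin.last 2)) B₁ * MvPowerSeries.X (Fin.last 2))) ∧
      ∃ φ : MvPowerSeries (Fin 2) k, MvPowerSeries.constantCoeff φ = 0 ∧
        (2 : ℕ∞) < (B₀ + B₁ * φ + φ ^ 2).order ∧ (1 : ℕ∞) < (B₁ + 2 * φ).order ∧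
        let good : MvPowerSeries (Fin 3) k → Prop := fun S =>
          (∃ θ : Fin 3 → MvPowerSeries (Fin 3) k, (∀ i, MvPowerSeries.constantCoeff (θ i) = 0) ∧
            IsUnit (Matrix.det (Matrix.of fun i j => MvPowerSeries.coeff (Finsupp.single j 1) (θ i))) ∧
            MvPowerSeries.coeff (Finsupp.single 0 2) (MvPowerSeries.subst θ S) = 0 ∧
            MvPowerSeries.coeff (Finsupp.single 1 2) (MvPowerSeries.subst θ S) = 0 ∧
            MvPowerSeries.coeff (Finsupp.single 0 1 + Finsupp.single 1 1) (MvPowerSeries.subst θ S) ≠ 0) ∨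
          (∃ (θ : Fin 3 → MvPowerSeries (Fin 3) k) (H : MvPowerSeries (Fin 3) k) (A₀' A₁' : MvPowerSeries (Fin 2) k),
            (∀ i, MvPowerSeries.constantCoeff (θ i) = 0) ∧ IsUnit (FormalCoordChange.linMat θ).det ∧
            MvPowerSeries.constantCoeff H ≠ 0 ∧ (2 : ℕ∞) < A₀'.order ∧ (1 : ℕ∞) < A₁'.order ∧
            MvPowerSeries.subst θ S =
              H * (MvPowerSeries.X (Fin.last 2) ^ 2 +
                (MvPowerSeries.rename (Fin.succAboveEmb (Fin.last 2)) A₀' +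
                  MvPowerSeries.rename (Fin.succAboveEmb (Fin.last 2)) A₁' * MvPowerSeries.X (Fin.last 2))) ∧
            κ A₀' A₁' < κ A₀ A₁)
        ((∀ (c : Fin 2 → k) (i₀ : Fin 2), c i₀ ≠ 0 → ∀ Bv : Fin 2 → MvPowerSeries (Fin 3) k,
            (∀ j : Fin 2, MvPowerSeries.subst (CobordantChart.chart (fun _ : Fin 2 => 1) c)
              ((![B₀ + B₁ * φ + φ ^ 2, B₁ + 2 * φ] : Fin 2 → MvPowerSeries (Fin 2) k) j) =
              MvPowerSeries.X 0 ^ (2 - (j : ℕ) + 1) * Bv j) →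
            ∀ S : MvPowerSeries (Fin 3) k, S = MvPowerSeries.X (Fin.last 2) ^ 2 +
              ∑ j : Fin 2, MvPowerSeries.rename (Fin.succAboveEmb (Fin.last 2))
                (TupleGame.slice i₀ (MvPowerSeries.X 0 * Bv j)) * MvPowerSeries.X (Fin.last 2) ^ (j : ℕ) →
            CobordantGame.IsSingular k S → good S) ∨
         (∃ (i : Fin 2) (A' : Fin 2 → MvPowerSeries (Fin 2) k),
            (∀ j : Fin 2, ((![B₀ + B₁ * φ + φ ^ 2, B₁ + 2 * φ] : Fin 2 → MvPowerSeries (Fin 2) k) j) =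
              MvPowerSeries.X i ^ (2 - (j : ℕ)) * A' j) ∧
            (∀ j : Fin 2, MvPowerSeries.constantCoeff (A' j) = 0) ∧
            ∀ ci : k, ci ≠ 0 → ∀ S : MvPowerSeries (Fin 3) k, S = MvPowerSeries.X (Fin.last 2) ^ 2 +
              ∑ j : Fin 2, MvPowerSeries.rename (Fin.succAboveEmb (Fin.last 2))
                (MvPowerSeries.C (ci ^ (2 - (j : ℕ))) * TupleGame.slice i
                  (MvPowerSeries.subst (CobordantChart.chart (fun l : Fin 2 => if l = i then 1 else 0)
                    (fun l : Fin 2 => if l = i then ci else 0)) (A' j))) *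
                MvPowerSeries.X (Fin.last 2) ^ (j : ℕ) →
              CobordantGame.IsSingular k S → good S))) :
    ∀ (k : Type) [Field k] [CharP k 2] [IsAlgClosed k],
      (∀ m : ℕ, m < 3 → ∀ g : MvPowerSeries (Fin m) k,
        CobordantGame.IsSingular k g → CobordantGame.Won k m g) →
      ∀ (f : MvPowerSeries (Fin 3) k), CobordantGame.IsSingular k f →
      (∀ g : MvPowerSeries (Fin 3) k, CobordantGame.IsSingular k g → g.order < f.order →
        CobordantGame.Won k 3 g) →
      f.order = 2 →
      (∃ ℓ : Fin 3 → k, ∀ i j : Fin 3,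
        MvPowerSeries.coeff (Finsupp.single i 1 + Finsupp.single j 1) f =
          MvPowerSeries.coeff (Finsupp.single i 1 + Finsupp.single j 1)
            ((∑ l, MvPowerSeries.C (ℓ l) * MvPowerSeries.X l) ^ 2)) →
      CobordantGame.Won k 3 f := by
  refine charTwoDoublePointSurfaceWon_of_monicForms fun k _ _ _ IH A₀ A₁ hA₀ hA₁ => ?_
  obtain ⟨κ, hκ⟩ := hN4 k
  exact monicDoublePointsWon_of_reducedFormalRank 2 Nat.prime_two k 0 (fun g hg => IH 1 (by omega) g hg) κ hκ A₀ A₁ hA₀ hA₁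

end Summit.ResolutionOfSingularities.ResolutionOfSingularities.Theorems
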